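import Mathlib

/-!
# Sumsets contained in the roots of unity: the Hanson–Petridis bound

B. Hanson and G. Petridis, *Refined estimates concerning sumsets contained in the roots of unity*,
Proc. London Math. Soc. (3) 122 (2021) 353–358 (arXiv:1905.09134), Theorem 2:

> Let `p` be a prime and suppose `A, B ⊆ 𝔽_p` satisfy `A + B ⊆ Z_d ∪ {0}` for some `d` properly dividing
> `p − 1`, where `Z_d = {x : x ^ d = 1}` is the subgroup of `d`-th roots of unity.  Then
> `|A| |B| ≤ d + |B ∩ (−A)|`.

For `d = (p − 1)/2` the set `Z_d` is the set of non-zero quadratic residues (Euler's criterion); the theorem then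
gives the Paley clique bound `ω(G_p) ≤ (√(2p − 1) + 1)/2` (Corollary 5 of the paper) and `|A| |B| = (p − 1)/2`
for decompositions `A + B = QR` (Corollary 3).  It is the only bound below the completion/Vinogradov estimate
`|A| |B| ≤ p` on record for sumsets inside the quadratic residues.

The proof is Stepanov's method of auxiliary polynomials exactly as in §2 of the paper, written without
derivatives: with the Lagrange/Vandermonde weights `w_a = ∏_{a' ≠ a} (a − a')⁻¹` of `A` (so that
`Σ_a w_a a^l = [l = M − 1]` for `l < M = |A|`, `sum_nodalWeight_mul_pow`), the polynomial
`F = Σ_{a ∈ A} w_a (X + a)^{d + M − 1} − 1` has degree `≤ d`, its `X^d`-coefficient is the binomial coefficient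
`C(d + M − 1, d) ≢ 0 (mod p)`, and the Taylor expansion `(X + a)^D = ((X − b) + (a + b))^D` at a point `b ∈ B`
shows `(X − b)^M ∣ F` when `−b ∉ A` and `(X − b)^{M−1} ∣ F` when `−b ∈ A`; counting roots gives the theorem.

Main statements
* `sum_nodalWeight_mul_eval_eq_coeff` — the top-coefficient identity of Lagrange interpolation (folklore);
* `card_mul_card_le_of_sumset_subset_rootsOfUnity` — Theorem 2 as printed (`d ∣ p − 1`, `d < p − 1`);
* `card_mul_card_le_of_sumset_subset_quadraticResidues` — the case `d = (p − 1)/2`, with membership in the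
  quadratic residues written by Euler's criterion `x ^ (p / 2) = 1`;
* `card_mul_card_sub_one_le_of_sub_subset_rootsOfUnity` — Corollary 5 (`A − A ⊆ Z_d ∪ {0} ⇒ |A|(|A|−1) ≤ d`,
  the Paley clique bound).

Deliberately not here: Corollaries 3, 4 (Shakan) and 6 of the paper (decompositions `A + B = Z_d`, density of
bad primes, `A ∸ A = Z_d`), the finite-field / prime-power versions, and anything about RESTRICTED sumsets
`A +̂ A` (free diagonal), where the method gives nothing below the counting bound.
-/

namespace Literature.Combinatorics.Additive.HansonPetridis

open Polynomial Finset

section Lagrange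

variable {F : Type*} [Field F] [DecidableEq F]

/-- **Top coefficient of Lagrange interpolation** [folklore].  If `f ∈ F[X]` has degree `< |A|` then
`Σ_{a ∈ A} w_a · f(a)` is the coefficient of `X^{|A| − 1}` in `f`, where `w_a = ∏_{a' ∈ A ∖ {a}} (a − a')⁻¹`
is the Lagrange nodal weight (`Lagrange.nodalWeight A id a`), i.e. the leading coefficient of the Lagrange basis
polynomial of `A` at `a`. -/
theorem sum_nodalWeight_mul_eval_eq_coeff (A : Finset F) (f : F[X]) (hf : f.degree < A.card) :
    ∑ a ∈ A, Lagrange.nodalWeight A id a * f.eval a = f.coeff (A.card - 1) := by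
  have hinj : Set.InjOn (id : F → F) A := Set.injOn_id _
  have h : f = Lagrange.interpolate A id fun a => f.eval (id a) := Lagrange.eq_interpolate hinj hf
  conv_rhs => rw [h]
  rw [Lagrange.interpolate_apply, finsetSum_coeff]
  refine Finset.sum_congr rfl fun a ha => ?_
  have hlc := Lagrange.leadingCoeff_basis hinj ha
  rw [Polynomial.leadingCoeff, Lagrange.natDegree_basis hinj ha] at hlc
  rw [coeff_C_mul, hlc, Lagrange.nodalWeight, prod_inv_distrib, mul_comm]
  rfl

/-- **Vandermonde identity behind Stepanov's method** [folklore]: for `l < |A|`,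
`Σ_{a ∈ A} w_a · a^l = [l = |A| − 1]` with the Lagrange nodal weights `w_a` of `A`. -/
theorem sum_nodalWeight_mul_pow (A : Finset F) (l : ℕ) (hl : l < A.card) :
    ∑ a ∈ A, Lagrange.nodalWeight A id a * a ^ l = if l = A.card - 1 then 1 else 0 := by
  have hdeg : (X ^ l : F[X]).degree < A.card := by
    rw [degree_X_pow]; exact_mod_cast hl
  have h := sum_nodalWeight_mul_eval_eq_coeff A (X ^ l) hdeg
  simp only [eval_pow, eval_X, coeff_X_pow] at h
  rw [h]
  by_cases hl' : l = A.card - 1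
  · simp [hl']
  · rw [if_neg hl', if_neg (Ne.symm hl')]

/-- The shifted form used in the proof: for `b ∈ F` and `e < |A|`,
`Σ_{a ∈ A} w_a · (a + b)^e = [e = |A| − 1]` [folklore]. -/
theorem sum_nodalWeight_mul_add_pow (A : Finset F) (b : F) (e : ℕ) (he : e < A.card) :
    ∑ a ∈ A, Lagrange.nodalWeight A id a * (a + b) ^ e = if e = A.card - 1 then 1 else 0 := by
  have hmon : ((X + C b) ^ e : F[X]).Monic := (monic_X_add_C b).pow e
  have hdeg : ((X + C b) ^ e : F[X]).degree < A.card := by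
    rw [degree_eq_natDegree hmon.ne_zero, (monic_X_add_C b).natDegree_pow, natDegree_X_add_C, mul_one]
    exact_mod_cast he
  have h := sum_nodalWeight_mul_eval_eq_coeff A ((X + C b) ^ e) hdeg
  simp only [eval_pow, eval_add, eval_X, eval_C, coeff_X_add_C_pow] at h
  rw [h]
  by_cases he' : e = A.card - 1
  · rw [if_pos he', he', Nat.sub_self, pow_zero, one_mul, Nat.choose_self, Nat.cast_one]
  · rw [if_neg he']
    have hlt : e < A.card - 1 := lt_of_le_of_ne (Nat.le_sub_one_of_lt he) he'
    rw [Nat.choose_eq_zero_of_lt hlt, Nat.cast_zero, mul_zero]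

end Lagrange

section Stepanov

variable {F : Type*} [Field F]

/-- **Taylor expansion of the Stepanov polynomial at a point `b`.**  For any finite `A ⊆ F`, weights `w`,
exponent `D` and point `b`,
`Σ_{a ∈ A} w_a (X + a)^D = Σ_{j ≤ D} C(D, j) · (Σ_{a ∈ A} w_a (a + b)^{D − j}) · (X − b)^j` [folklore]. -/
theorem sum_C_mul_X_add_C_pow_eq (A : Finset F) (w : F → F) (D : ℕ) (b : F) :
    ∑ a ∈ A, C (w a) * (X + C a) ^ D =
      ∑ j ∈ range (D + 1),
        C ((D.choose j : F) * ∑ a ∈ A, w a * (a + b) ^ (D - j)) * (X - C b) ^ j := by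
  have key : ∀ a : F, (X + C a) ^ D =
      ∑ j ∈ range (D + 1), C ((D.choose j : F) * (a + b) ^ (D - j)) * (X - C b) ^ j := by
    intro a
    have hX : (X + C a : F[X]) = (X - C b) + C (a + b) := by
      rw [map_add]; ring
    rw [hX, add_pow]
    refine Finset.sum_congr rfl fun j _ => ?_
    rw [map_mul, map_natCast, ← C_pow]
    ring
  simp_rw [key, Finset.mul_sum]
  rw [Finset.sum_comm]
  refine Finset.sum_congr rfl fun j _ => ?_
  rw [map_sum, Finset.sum_mul]
  refine Finset.sum_congr rfl fun a _ => ?_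
  rw [← mul_assoc, ← map_mul]
  congr 2
  ring

end Stepanov

section Main

/-- **Hanson–Petridis, Theorem 2** [cite: HansonPetridis2020, Thm 2].  Let `p` be a prime and let
`A, B ⊆ 𝔽_p` satisfy `A + B ⊆ Z_d ∪ {0}`, where `Z_d = {x : x ^ d = 1}`, for some `d` properly dividing
`p − 1` (`d ∣ p − 1` and `d < p − 1`).  Then `|A| · |B| ≤ d + |B ∩ (−A)|`.  The hypothesis
`a + b = 0 ∨ (a + b) ^ d = 1` is membership of `a + b` in `Z_d ∪ {0}`; `B ∩ (−A)` is written as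
`{b ∈ B : −b ∈ A}`. -/
theorem card_mul_card_le_of_sumset_subset_rootsOfUnity {p : ℕ} [hp : Fact p.Prime] {d : ℕ}
    (hd : d ∣ p - 1) (hdp : d < p - 1) (A B : Finset (ZMod p))
    (hAB : ∀ a ∈ A, ∀ b ∈ B, a + b = 0 ∨ (a + b) ^ d = 1) :
    A.card * B.card ≤ d + (B.filter fun b => -b ∈ A).card := by
  classical
  -- trivial cases `A = ∅`, `B = ∅`
  rcases A.eq_empty_or_nonempty with rfl | hAne
  · simp
  rcases B.eq_empty_or_nonempty with rfl | ⟨b₀, hb₀⟩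
  · simp
  set M := A.card with hM
  have hMpos : 0 < M := hAne.card_pos
  have hp2 : 2 ≤ p := hp.out.two_le
  -- `d ≥ 1` and `2d ≤ p − 1` (a proper divisor is at most half)
  have hd0 : 0 < d := Nat.pos_of_dvd_of_pos hd (by omega)
  have h2d : 2 * d ≤ p - 1 := by
    obtain ⟨k, hk⟩ := hd
    rcases k with _ | _ | k
    · omega
    · omega
    · nlinarith
  -- `M ≤ d + 1`: `A + b₀` sits injectively inside `{0} ∪ {x : x ^ d = 1}`, a set of size `≤ d + 1`
  have hMd : M ≤ d + 1 := by
    have hsub : A.image (· + b₀) ⊆ insert 0 (Polynomial.nthRoots d (1 : ZMod p)).toFinset := by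
      intro x hx
      rw [mem_image] at hx
      obtain ⟨a, ha, rfl⟩ := hx
      rcases hAB a ha b₀ hb₀ with h0 | h1
      · rw [h0]; exact mem_insert_self _ _
      · exact mem_insert_of_mem (Multiset.mem_toFinset.mpr ((Polynomial.mem_nthRoots hd0).mpr h1))
    calc M = (A.image (· + b₀)).card := (card_image_of_injective _ (add_left_injective b₀)).symm
      _ ≤ (insert (0 : ZMod p) (Polynomial.nthRoots d (1 : ZMod p)).toFinset).card := card_le_card hsub
      _ ≤ (Polynomial.nthRoots d (1 : ZMod p)).toFinset.card + 1 := card_insert_le _ _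
      _ ≤ d + 1 := by
        gcongr
        exact (Multiset.toFinset_card_le _).trans (Polynomial.card_nthRoots d 1)
  -- the exponent `D = d + M − 1 < p`
  set D := d + M - 1 with hD
  have hDp : D < p := by omega
  have hMD : M ≤ D := by omega
  have hDd : D - d = M - 1 := by omega
  -- the Lagrange / Vandermonde weights of `A`
  set w : ZMod p → ZMod p := fun a => Lagrange.nodalWeight A id a with hw
  have hwpow : ∀ e : ℕ, e < M → ∀ b : ZMod p,
      ∑ a ∈ A, w a * (a + b) ^ e = if e = M - 1 then 1 else 0 :=
    fun e he b => sum_nodalWeight_mul_add_pow A b e he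
  -- Stepanov's auxiliary polynomial
  set Fp : (ZMod p)[X] := (∑ a ∈ A, C (w a) * (X + C a) ^ D) - 1 with hFp
  -- (1) its coefficients above `d` vanish, and its `X^d`-coefficient is `C(D, d) ≠ 0`
  have hcoeff : ∀ n : ℕ, Fp.coeff n =
      (∑ a ∈ A, w a * a ^ (D - n)) * (D.choose n : ZMod p) - if n = 0 then 1 else 0 := by
    intro n
    rw [hFp, coeff_sub, coeff_one, finsetSum_coeff, Finset.sum_mul]
    congr 1
    refine Finset.sum_congr rfl fun a _ => ?_
    rw [coeff_C_mul, coeff_X_add_C_pow, mul_assoc]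
  have hdeg : Fp.natDegree ≤ d := by
    rw [natDegree_le_iff_coeff_eq_zero]
    intro n hn
    rw [hcoeff n, if_neg (by omega)]
    by_cases hnD : n ≤ D
    · have hlt : D - n < M := by omega
      have hne : D - n ≠ M - 1 := by omega
      have h0 := hwpow (D - n) hlt 0
      rw [if_neg hne] at h0
      simp only [add_zero] at h0
      rw [h0, zero_mul, sub_zero]
    · rw [Nat.choose_eq_zero_of_lt (by omega), Nat.cast_zero, mul_zero, sub_zero]
  have hchoose : (D.choose d : ZMod p) ≠ 0 := by
    intro h0
    rw [ZMod.natCast_eq_zero_iff] at h0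
    have hfac : p ∣ D.factorial := by
      have := Nat.choose_mul_factorial_mul_factorial (show d ≤ D by omega)
      exact h0.trans (Dvd.intro (d.factorial * (D - d).factorial) (by rw [← this]; ring))
    rw [hp.out.dvd_factorial] at hfac
    omega
  have hcoeffd : Fp.coeff d = (D.choose d : ZMod p) := by
    rw [hcoeff d, if_neg (by omega), hDd]
    have h1 := hwpow (M - 1) (by omega) 0
    rw [if_pos rfl] at h1
    simp only [add_zero] at h1
    rw [h1, one_mul, sub_zero]
  have hFp0 : Fp ≠ 0 := fun h => hchoose (by rw [← hcoeffd, h, coeff_zero])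
  -- (2) root multiplicities: `M` at `b ∈ B` with `−b ∉ A`, `M − 1` when `−b ∈ A`
  set mult : ZMod p → ℕ := fun b => if -b ∈ A then M - 1 else M with hmult
  have hmultM : ∀ b, mult b ≤ M := fun b => by
    simp only [hmult]; split_ifs <;> omega
  have hroot : ∀ b ∈ B, (X - C b) ^ mult b ∣ Fp := by
    intro b hb
    -- the Taylor coefficients `e_j = C(D, j) · Σ_a w_a (a + b)^{D − j}` of the sum part
    have hT : ∀ j : ℕ, j < mult b →
        (D.choose j : ZMod p) * ∑ a ∈ A, w a * (a + b) ^ (D - j) = if j = 0 then 1 else 0 := by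
      intro j hj
      have hjM : j < M := lt_of_lt_of_le hj (hmultM b)
      -- replace `(a + b)^{D − j}` by `(a + b)^{M − 1 − j}` termwise
      have hterm : ∀ a ∈ A, w a * (a + b) ^ (D - j) = w a * (a + b) ^ (M - 1 - j) := by
        intro a ha
        have hsplit : D - j = d + (M - 1 - j) := by omega
        rcases hAB a ha b hb with h0 | h1
        · -- `a = −b`, so `−b ∈ A` and `mult b = M − 1`; both powers of `0` vanish
          have hbA : -b ∈ A := by
            have : a = -b := eq_neg_of_add_eq_zero_left h0
            rwa [this] at ha
          have hmb : mult b = M - 1 := by simp only [hmult, if_pos hbA]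
          rw [hmb] at hj
          rw [h0, zero_pow (by omega), zero_pow (by omega)]
        · rw [hsplit, pow_add, h1, one_mul]
      rw [Finset.sum_congr rfl hterm, hwpow (M - 1 - j) (by omega) b]
      by_cases hj0 : j = 0
      · subst hj0
        rw [if_pos (by omega), if_pos rfl, Nat.choose_zero_right, Nat.cast_one, one_mul]
      · rw [if_neg (by omega), if_neg hj0, mul_zero]
    -- split the Taylor expansion at `mult b`
    have hexp := sum_C_mul_X_add_C_pow_eq A w D b
    have hmD : mult b ≤ D + 1 := (hmultM b).trans (by omega)
    rw [hFp, hexp, ← Finset.sum_range_add_sum_Ico _ hmD]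
    have hlow : ∑ j ∈ range (mult b),
        C ((D.choose j : ZMod p) * ∑ a ∈ A, w a * (a + b) ^ (D - j)) * (X - C b) ^ j =
          if 0 < mult b then 1 else 0 := by
      rcases Nat.eq_zero_or_pos (mult b) with h0 | hpos
      · rw [h0, sum_range_zero, if_neg (lt_irrefl 0)]
      · rw [if_pos hpos, Finset.sum_eq_single_of_mem 0 (mem_range.mpr hpos)]
        · rw [hT 0 hpos, if_pos rfl, map_one, one_mul, pow_zero]
        · intro j hj hj0
          rw [hT j (mem_range.mp hj), if_neg hj0, map_zero, zero_mul]
    rw [hlow]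
    rcases Nat.eq_zero_or_pos (mult b) with h0 | hpos
    · rw [h0, pow_zero]; exact one_dvd _
    · rw [if_pos hpos, add_sub_cancel_left]
      refine Finset.dvd_sum fun j hj => ?_
      exact Dvd.dvd.mul_left (pow_dvd_pow (X - C b) (mem_Ico.mp hj).1) _
  -- (3) the product of these coprime prime powers divides `Fp`, so the multiplicities sum to `≤ d`
  have hprod : (∏ b ∈ B, (X - C b) ^ mult b) ∣ Fp := by
    refine Finset.prod_dvd_of_coprime ?_ hroot
    intro b _ b' _ hbb'
    exact (pairwise_coprime_X_sub_C (K := ZMod p) Function.injective_id hbb').pow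
  have hsum : ∑ b ∈ B, mult b ≤ d := by
    have h1 : (∏ b ∈ B, (X - C b) ^ mult b).natDegree = ∑ b ∈ B, mult b := by
      rw [natDegree_prod_of_monic _ _ fun b _ => (monic_X_sub_C b).pow (mult b)]
      refine Finset.sum_congr rfl fun b _ => ?_
      rw [(monic_X_sub_C b).natDegree_pow, natDegree_X_sub_C, mul_one]
    rw [← h1]
    exact (natDegree_le_of_dvd hprod hFp0).trans hdeg
  -- (4) bookkeeping: `Σ_b mult b + |{b ∈ B : −b ∈ A}| = M · |B|`
  have hbook : ∑ b ∈ B, mult b + (B.filter fun b => -b ∈ A).card = M * B.card := by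
    rw [card_filter, ← Finset.sum_add_distrib]
    rw [Finset.sum_congr rfl (g := fun _ => M), sum_const, smul_eq_mul, mul_comm]
    intro b _
    simp only [hmult]
    split_ifs
    · omega
    · omega
  calc A.card * B.card = M * B.card := by rw [hM]
    _ = ∑ b ∈ B, mult b + (B.filter fun b => -b ∈ A).card := hbook.symm
    _ ≤ d + (B.filter fun b => -b ∈ A).card := by gcongr

/-- **Hanson–Petridis for the quadratic residues** (the case `d = (p − 1)/2` of Theorem 2)
[cite: HansonPetridis2020, Thm 2].  Let `p` be an odd prime and `A, B ⊆ 𝔽_p` such that every sum `a + b`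
(`a ∈ A`, `b ∈ B`) is `0` or a non-zero quadratic residue, the latter written by Euler's criterion as
`(a + b) ^ (p / 2) = 1`.  Then `|A| · |B| ≤ (p − 1)/2 + |{b ∈ B : −b ∈ A}|`. -/
theorem card_mul_card_le_of_sumset_subset_quadraticResidues {p : ℕ} [hp : Fact p.Prime] (hp2 : p ≠ 2)
    (A B : Finset (ZMod p)) (hAB : ∀ a ∈ A, ∀ b ∈ B, a + b = 0 ∨ (a + b) ^ (p / 2) = 1) :
    A.card * B.card ≤ p / 2 + (B.filter fun b => -b ∈ A).card := by
  have hodd : p % 2 = 1 := Nat.odd_iff.mp (hp.out.odd_of_ne_two hp2)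
  have hp3 : 3 ≤ p := by
    have := hp.out.two_le
    omega
  exact card_mul_card_le_of_sumset_subset_rootsOfUnity ⟨2, by omega⟩ (by omega) A B hAB

/-- **Hanson–Petridis, Corollary 5** (clique numbers of Paley-type graphs) [cite: HansonPetridis2020, Cor 5].
If `A ⊆ 𝔽_p` satisfies `A − A ⊆ Z_d ∪ {0}` for some `d` properly dividing `p − 1`, then `|A| (|A| − 1) ≤ d`.
For `p ≡ 1 (mod 4)` and `d = (p − 1)/2` this is the Paley clique bound `ω(G_p) ≤ (√(2p − 1) + 1)/2`. -/
theorem card_mul_card_sub_one_le_of_sub_subset_rootsOfUnity {p : ℕ} [Fact p.Prime] {d : ℕ}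
    (hd : d ∣ p - 1) (hdp : d < p - 1) (A : Finset (ZMod p))
    (hA : ∀ a ∈ A, ∀ a' ∈ A, a = a' ∨ (a - a') ^ d = 1) :
    A.card * (A.card - 1) ≤ d := by
  classical
  have h := card_mul_card_le_of_sumset_subset_rootsOfUnity hd hdp A (A.image Neg.neg) ?_
  · rw [card_image_of_injective _ neg_injective] at h
    have hfilter : ((A.image Neg.neg).filter fun b => -b ∈ A).card ≤ A.card :=
      (card_filter_le _ _).trans (card_image_of_injective _ neg_injective).le
    have h' : A.card * A.card ≤ d + A.card := h.trans (by omega)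
    rw [Nat.mul_sub_one]
    omega
  · intro a ha b hb
    rw [mem_image] at hb
    obtain ⟨a', ha', rfl⟩ := hb
    rcases hA a ha a' ha' with h | h
    · left
      rw [h, add_neg_cancel]
    · right
      rwa [← sub_eq_add_neg]

end Main

end Literature.Combinatorics.Additive.HansonPetridis
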